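import Mathlib
import Summits.Ventures.HodgeRepro2.CanonicalAutomorphyFactor
import Summits.Ventures.HodgeRepro2.InvariantFormsSpace
import Summits.Ventures.HodgeRepro2.LevelDiscrete

/-!
# Automorphic forms on the ball; the wedge of two invariant 1-forms has weight 3

Kernel annex of the blind cell `pub-hodge-repro2` (seat p2), Tier-3 hypothesis shapes of
`Hypothesis.lean`.  Shimura 1979 works with holomorphic automorphic forms
`f(γz) = j(γ, z)^k f(z)` on the ball (§4–§5, the factor `j` of (4.2)); the objects of the
transfer are holomorphic forms on `Γ\𝔹²`.  This file records the dictionary between the two for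
the 2-forms of `NonVanishingInput`:

* `IsAutomorphicForm Γ' k f`: `f` holomorphic on the ball and `f(γz) = j(γ,z)^k f(z)` for the
  elements `γ` of a set `Γ' ⊆ U(2,1)`; the automorphic forms of a given weight form a ℂ-subspace
  (`automorphicForms`);
* `det_realEmbedding`: the determinant of the image of `γ ∈ GL₃(K)` in `U(2,1)` is `τ₁(det γ)`,
  so it is `1` on `SU(H)(K)`, in particular on every `Γ ⊆ Γ_N` (`det_realEmbedding_eq_one`);
* **`isAutomorphicForm_wedgeAt`**: for holomorphic `q₁, q₂` invariant under the image of
  `Γ ⊆ Γ_N`, the wedge coefficient `q₁ ∧ q₂` is an automorphic form of weight 3 for that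
  image — the holomorphic 2-forms on `Γ\𝔹²` supplied by Shimura's Thm 8.1 ARE weight-3
  automorphic forms, and `WedgeNonzero` says this form is not identically zero.
-/

namespace Summit.Ventures.HodgeRepro2.ShimuraData

open Matrix

/-- A holomorphic automorphic form of weight `k` on the ball for a set `Γ'` of matrices:
holomorphic on the ball, and `f(γz) = j(γ, z)^k · f(z)` for every `γ ∈ Γ'` and `z` in the ball. -/
def IsAutomorphicForm (Γ' : Set (Matrix (Fin 3) (Fin 3) ℂ)) (k : ℕ) (f : (Fin 2 → ℂ) → ℂ) :
    Prop :=
  DifferentiableOn ℂ f ball₂ ∧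
    ∀ γ ∈ Γ', ∀ z ∈ ball₂, f (ballAction γ z) = autFactor γ z ^ k * f z

/-- The zero function is an automorphic form of every weight. -/
theorem isAutomorphicForm_zero (Γ' : Set (Matrix (Fin 3) (Fin 3) ℂ)) (k : ℕ) :
    IsAutomorphicForm Γ' k 0 :=
  ⟨differentiableOn_const 0, fun _ _ _ _ => by simp⟩

/-- Automorphic forms of a given weight are closed under addition. -/
theorem IsAutomorphicForm.add {Γ' : Set (Matrix (Fin 3) (Fin 3) ℂ)} {k : ℕ}
    {f g : (Fin 2 → ℂ) → ℂ} (hf : IsAutomorphicForm Γ' k f) (hg : IsAutomorphicForm Γ' k g) :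
    IsAutomorphicForm Γ' k (f + g) :=
  ⟨hf.1.add hg.1, fun γ hγ z hz => by
    simp only [Pi.add_apply, hf.2 γ hγ z hz, hg.2 γ hγ z hz, mul_add]⟩

/-- Automorphic forms of a given weight are closed under scalar multiplication. -/
theorem IsAutomorphicForm.smul {Γ' : Set (Matrix (Fin 3) (Fin 3) ℂ)} {k : ℕ}
    {f : (Fin 2 → ℂ) → ℂ} (hf : IsAutomorphicForm Γ' k f) (c : ℂ) :
    IsAutomorphicForm Γ' k (c • f) :=
  ⟨hf.1.const_smul c, fun γ hγ z hz => by
    simp only [Pi.smul_apply, smul_eq_mul, hf.2 γ hγ z hz]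
    ring⟩

/-- The ℂ-vector space of holomorphic automorphic forms of weight `k` for `Γ'`. -/
def automorphicForms (Γ' : Set (Matrix (Fin 3) (Fin 3) ℂ)) (k : ℕ) :
    Submodule ℂ ((Fin 2 → ℂ) → ℂ) where
  carrier := {f | IsAutomorphicForm Γ' k f}
  add_mem' hf hg := hf.add hg
  zero_mem' := isAutomorphicForm_zero Γ' k
  smul_mem' c _ hf := hf.smul c

/-- Membership in the space of automorphic forms. -/
theorem mem_automorphicForms {Γ' : Set (Matrix (Fin 3) (Fin 3) ℂ)} {k : ℕ}
    {f : (Fin 2 → ℂ) → ℂ} : f ∈ automorphicForms Γ' k ↔ IsAutomorphicForm Γ' k f :=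
  Iff.rfl

section determinant

variable {K : Type*} [Field K] [NumberField K] [NumberField.IsCMField K]
  {τ₁ : K →+* ℂ} {H : Matrix (Fin 3) (Fin 3) K} {Q : Matrix (Fin 3) (Fin 3) ℂ}

omit [NumberField K] [NumberField.IsCMField K] in
/-- The determinant of the image of `γ` in `U(2,1)` through a frame is `τ₁(det γ)`. -/
theorem det_realEmbedding (hQ : IsFrame K τ₁ H Q) (γ : GL (Fin 3) K) :
    (realEmbedding K τ₁ Q γ).det = τ₁ (γ : Matrix (Fin 3) (Fin 3) K).det := by
  rw [realEmbedding, Matrix.det_conj ((Matrix.isUnit_iff_isUnit_det Q).2 hQ.2), RingHom.map_det]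
  rfl

/-- For `γ ∈ SU(H)(K)` the image in `U(2,1)` has determinant `1`. -/
theorem det_realEmbedding_eq_one (hQ : IsFrame K τ₁ H Q) {γ : GL (Fin 3) K}
    (hγ : γ ∈ specialUnitaryGroup K H) : (realEmbedding K τ₁ Q γ).det = 1 := by
  rw [det_realEmbedding hQ]
  have h : Matrix.GeneralLinearGroup.det γ = 1 := hγ.2
  have h' := congrArg Units.val h
  rw [Matrix.GeneralLinearGroup.val_det_apply, Units.val_one] at h'
  rw [h', map_one]

/-- Every element of Shimura's `Γ_N` has determinant-one image in `U(2,1)`. -/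
theorem det_realEmbedding_eq_one_of_mem_shimuraLevel (hQ : IsFrame K τ₁ H Q)
    {𝔪 : Submodule ℤ (Fin 3 → K)} {N : ℕ} {γ : GL (Fin 3) K} (hγ : γ ∈ shimuraLevel K H 𝔪 N) :
    (realEmbedding K τ₁ Q γ).det = 1 :=
  det_realEmbedding_eq_one hQ hγ.1

/-- For `γ ∈ Γ_N` and `Γ_N`-invariant holomorphic 1-forms, the wedge transforms with the
automorphy factor of weight 3 and trivial character. -/
theorem wedgeAt_ballAction_realEmbedding (hQ : IsFrame K τ₁ H Q) {𝔪 : Submodule ℤ (Fin 3 → K)}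
    {N : ℕ} {γ : GL (Fin 3) K} (hγ : γ ∈ shimuraLevel K H 𝔪 N) {q₁ q₂ : (Fin 2 → ℂ) → Fin 2 → ℂ}
    (h₁ : IsInvariantUnder (realEmbedding K τ₁ Q γ) q₁)
    (h₂ : IsInvariantUnder (realEmbedding K τ₁ Q γ) q₂) {z : Fin 2 → ℂ} (hz : z ∈ ball₂) :
    wedgeAt q₁ q₂ (ballAction (realEmbedding K τ₁ Q γ) z) =
      autFactor (realEmbedding K τ₁ Q γ) z ^ 3 * wedgeAt q₁ q₂ z :=
  wedgeAt_ballAction_eq_of_det_eq_one (hQ.isInU21_realEmbedding (mem_unitaryGroup_of_mem_shimuraLevel hγ))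
    (det_realEmbedding_eq_one_of_mem_shimuraLevel hQ hγ) h₁ h₂ hz

/-- **The wedge of two `Γ`-invariant holomorphic 1-forms is a weight-3 automorphic form** for
the image of `Γ ⊆ Γ_N` in `U(2,1)`. -/
theorem isAutomorphicForm_wedgeAt (hQ : IsFrame K τ₁ H Q) {𝔪 : Submodule ℤ (Fin 3 → K)} {N : ℕ}
    {Γ : Set (GL (Fin 3) K)} (hΓ : Γ ⊆ shimuraLevel K H 𝔪 N) {q₁ q₂ : (Fin 2 → ℂ) → Fin 2 → ℂ}
    (hq₁ : IsHolomorphicOneForm q₁) (hq₂ : IsHolomorphicOneForm q₂)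
    (h₁ : ∀ γ ∈ Γ, IsInvariantUnder (realEmbedding K τ₁ Q γ) q₁)
    (h₂ : ∀ γ ∈ Γ, IsInvariantUnder (realEmbedding K τ₁ Q γ) q₂) :
    IsAutomorphicForm (realEmbedding K τ₁ Q '' Γ) 3 (wedgeAt q₁ q₂) := by
  refine ⟨?_, ?_⟩
  · intro z hz
    refine DifferentiableAt.differentiableWithinAt ?_
    exact ((hq₁.differentiableAt_apply hz 0).mul (hq₂.differentiableAt_apply hz 1)).sub
      ((hq₁.differentiableAt_apply hz 1).mul (hq₂.differentiableAt_apply hz 0))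
  · rintro _ ⟨γ, hγ, rfl⟩ z hz
    exact wedgeAt_ballAction_realEmbedding hQ (hΓ hγ) (h₁ γ hγ) (h₂ γ hγ) hz

/-- The conclusion of `NonVanishingInput`, read as an automorphic form: the group `Γ` it
produces carries two closed holomorphic `Γ`-invariant 1-forms whose wedge is a NON-ZERO
weight-3 automorphic form for the image of `Γ`. -/
theorem NonVanishingInput.exists_isAutomorphicForm_ne_zero (hQ : IsFrame K τ₁ H Q)
    {𝔪 : Submodule ℤ (Fin 3 → K)} (h : NonVanishingInput K τ₁ H 𝔪 Q) :
    ∃ Γ : Set (GL (Fin 3) K), IsFiniteIndexSubgroupOf K Γ (shimuraLevel K H 𝔪 1) ∧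
      ∃ f : (Fin 2 → ℂ) → ℂ, IsAutomorphicForm (realEmbedding K τ₁ Q '' Γ) 3 f ∧
        ∃ z ∈ ball₂, f z ≠ 0 := by
  obtain ⟨Γ, hΓ, q₁, q₂, hq₁, hq₂, -, -, h₁, h₂, hw⟩ := h
  refine ⟨Γ, hΓ, wedgeAt q₁ q₂, isAutomorphicForm_wedgeAt hQ (IsFiniteIndexSubgroupOf.subset hΓ) hq₁ hq₂ h₁ h₂, hw⟩

end determinant

/-- Automorphic forms for a set of matrices are automorphic forms for every subset. -/
theorem IsAutomorphicForm.mono {Γ' Γ'' : Set (Matrix (Fin 3) (Fin 3) ℂ)} (h : Γ'' ⊆ Γ') {k : ℕ}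
    {f : (Fin 2 → ℂ) → ℂ} (hf : IsAutomorphicForm Γ' k f) : IsAutomorphicForm Γ'' k f :=
  ⟨hf.1, fun γ hγ => hf.2 γ (h hγ)⟩

/-- The space of automorphic forms grows when the set of matrices shrinks. -/
theorem automorphicForms_mono {Γ' Γ'' : Set (Matrix (Fin 3) (Fin 3) ℂ)} (h : Γ'' ⊆ Γ') (k : ℕ) :
    automorphicForms Γ' k ≤ automorphicForms Γ'' k :=
  fun _ hf => IsAutomorphicForm.mono h hf

end Summit.Ventures.HodgeRepro2.ShimuraData
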